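import Summits.QuantumFields.QCD.Theorems.SmallFieldUltracontractivity.Negative.Tightness

/-!
# Caloric fixed point — part A: finite-dimensional row calculus and the integral duality lemma
(helpers of the line lead for `stub_caloricFixedPoint`, crux `SmallFieldUltracontractivity`,
item stmt-QuantumFields-8871, line `point-centred-axial-parabolic`)

Elementary facts about the `ℓ²`/`ℓ¹` norms of ROWS of products of complex matrices (finite index
types), and the duality form of Minkowski's inequality for a row given entrywise by interval integrals:

* `sqrt_rowSq_add_le` — triangle inequality for `√(Σ_j ‖(X + Y) i j‖²)`;
* `sqrt_rowSq_mul_le` — `√(Σ_j ‖(X Y) i j‖²) ≤ Σ_k ‖X i k‖ · √(Σ_j ‖Y k j‖²)`;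
* `sum_norm_mul_le` — `Σ_j ‖(X Y) i j‖ ≤ Σ_k ‖X i k‖ · Σ_j ‖Y k j‖`;
* `abs_sum_mul_le_sqrt_mul_sqrt` — Cauchy–Schwarz `|Σ_j conj(v_j) w_j| ≤ ‖v‖₂ ‖w‖₂`;
* `sqrt_sum_norm_sq_le_integral_of_forall_le` — if `v_j = ∫_a^b F(τ)_j dτ` with continuous `F(·)_j`
  and `√(Σ_j ‖F(τ)_j‖²) ≤ G(τ)` on `[a,b]` (`G` continuous), then `√(Σ_j ‖v_j‖²) ≤ ∫_a^b G`.

Pure Mathlib; no named facts.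
-/

noncomputable section

namespace Summit.QuantumFields.QCD.Cruxes.SmallFieldUltracontractivity.PointCentredAxialParabolic

open scoped Matrix ComplexConjugate
open MeasureTheory intervalIntegral

variable {ι : Type*} [Fintype ι]

/-! ### Rows as Euclidean vectors -/

/-- The Euclidean norm of a finite family, squared, is the sum of the squared norms. -/
theorem norm_toLp_two_sq (w : ι → ℂ) : ‖WithLp.toLp 2 w‖ ^ 2 = ∑ j, ‖w j‖ ^ 2 := by
  rw [EuclideanSpace.norm_eq, Real.sq_sqrt (Finset.sum_nonneg fun _ _ => by positivity)]

/-- The Euclidean norm of a finite family is `√(Σ_j ‖w j‖²)`. -/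
theorem norm_toLp_two_eq_sqrt (w : ι → ℂ) : ‖WithLp.toLp 2 w‖ = Real.sqrt (∑ j, ‖w j‖ ^ 2) := by
  rw [EuclideanSpace.norm_eq]

/-- **Triangle inequality for row `ℓ²` norms.** -/
theorem sqrt_sum_norm_sq_add_le (v w : ι → ℂ) :
    Real.sqrt (∑ j, ‖v j + w j‖ ^ 2) ≤ Real.sqrt (∑ j, ‖v j‖ ^ 2) + Real.sqrt (∑ j, ‖w j‖ ^ 2) := by
  have h := norm_add_le (WithLp.toLp 2 v) (WithLp.toLp 2 w)
  rw [← WithLp.toLp_add, norm_toLp_two_eq_sqrt, norm_toLp_two_eq_sqrt, norm_toLp_two_eq_sqrt] at h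
  exact h

/-- Row `ℓ²` norm of a finite sum of families is at most the sum of the row `ℓ²` norms. -/
theorem sqrt_sum_norm_sq_sum_le {κ : Type*} (s : Finset κ) (v : κ → ι → ℂ) :
    Real.sqrt (∑ j, ‖∑ k ∈ s, v k j‖ ^ 2) ≤ ∑ k ∈ s, Real.sqrt (∑ j, ‖v k j‖ ^ 2) := by
  have h := norm_sum_le s (fun k => WithLp.toLp 2 (v k))
  have hsum : ∑ k ∈ s, WithLp.toLp 2 (v k) = WithLp.toLp 2 (∑ k ∈ s, v k) := by
    rw [WithLp.toLp_sum]
  rw [hsum, norm_toLp_two_eq_sqrt] at h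
  simp only [norm_toLp_two_eq_sqrt] at h
  convert h using 3
  simp [Finset.sum_apply]

/-- **Rows of a product.** `√(Σ_j ‖(X Y) i j‖²) ≤ Σ_k ‖X i k‖ · √(Σ_j ‖Y k j‖²)`: the `i`-th row of
`X Y` is the combination `Σ_k X_{ik} · row_k(Y)`. -/
theorem sqrt_rowSq_mul_le {κ : Type*} [Fintype κ] (X : Matrix ι κ ℂ) (Y : Matrix κ ι ℂ) (i : ι) :
    Real.sqrt (∑ j, ‖(X * Y) i j‖ ^ 2) ≤ ∑ k, ‖X i k‖ * Real.sqrt (∑ j, ‖Y k j‖ ^ 2) := by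
  have h := sqrt_sum_norm_sq_sum_le (ι := ι) Finset.univ (fun k j => X i k * Y k j)
  simp only [Matrix.mul_apply] at h ⊢
  refine h.trans (le_of_eq (Finset.sum_congr rfl fun k _ => ?_))
  have : ∑ j, ‖X i k * Y k j‖ ^ 2 = ‖X i k‖ ^ 2 * ∑ j, ‖Y k j‖ ^ 2 := by
    rw [Finset.mul_sum]
    refine Finset.sum_congr rfl fun j _ => ?_
    rw [norm_mul, mul_pow]
  rw [this, Real.sqrt_mul (sq_nonneg _), Real.sqrt_sq (norm_nonneg _)]

/-- **Row `ℓ¹` norms of a product.** `Σ_j ‖(X Y) i j‖ ≤ Σ_k ‖X i k‖ · Σ_j ‖Y k j‖`. -/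
theorem sum_norm_mul_le {κ : Type*} [Fintype κ] (X : Matrix ι κ ℂ) (Y : Matrix κ ι ℂ) (i : ι) :
    ∑ j, ‖(X * Y) i j‖ ≤ ∑ k, ‖X i k‖ * ∑ j, ‖Y k j‖ := by
  calc ∑ j, ‖(X * Y) i j‖ ≤ ∑ j, ∑ k, ‖X i k‖ * ‖Y k j‖ := by
        refine Finset.sum_le_sum fun j _ => ?_
        rw [Matrix.mul_apply]
        exact (norm_sum_le _ _).trans (le_of_eq (Finset.sum_congr rfl fun k _ => norm_mul _ _))
    _ = ∑ k, ‖X i k‖ * ∑ j, ‖Y k j‖ := by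
        rw [Finset.sum_comm]
        refine Finset.sum_congr rfl fun k _ => ?_
        rw [Finset.mul_sum]

/-- **Cauchy–Schwarz** for the pairing `Σ_j conj(v_j) w_j`. -/
theorem norm_sum_conj_mul_le (v w : ι → ℂ) :
    ‖∑ j, conj (v j) * w j‖ ≤ Real.sqrt (∑ j, ‖v j‖ ^ 2) * Real.sqrt (∑ j, ‖w j‖ ^ 2) := by
  have h := norm_inner_le_norm (𝕜 := ℂ) (WithLp.toLp 2 v) (WithLp.toLp 2 w)
  rw [norm_toLp_two_eq_sqrt, norm_toLp_two_eq_sqrt] at h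
  refine le_trans (le_of_eq ?_) h
  rw [EuclideanSpace.inner_toLp_toLp, dotProduct]
  congr 1
  refine Finset.sum_congr rfl fun j _ => ?_
  rw [mul_comm]
  rfl

/-- A row is bounded in `ℓ²` by any `M ≥ 0` that bounds its pairings with itself direction:
if `‖v‖₂² ≤ M ‖v‖₂` then `‖v‖₂ ≤ M`. -/
theorem sqrt_le_of_sq_le_mul {a M : ℝ} (ha : 0 ≤ a) (hM : 0 ≤ M) (h : a ^ 2 ≤ M * a) : a ≤ M := by
  rcases eq_or_lt_of_le ha with h0 | hpos
  · rw [← h0]; exact hM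
  · nlinarith

/-! ### Minkowski by duality for rows given by interval integrals -/

/-- **Duality form of Minkowski's integral inequality for a row.**  If each component of the finite
family `v` is the interval integral of a continuous function, `v_j = ∫_a^b F(τ)_j dτ` (`a ≤ b`), and
the row norm of `F(τ)` is dominated on `[a,b]` by a continuous `G`, then `‖v‖₂ ≤ ∫_a^b G`. -/
theorem sqrt_sum_norm_sq_le_integral_of_forall_le (v : ι → ℂ) (F : ℝ → ι → ℂ) (G : ℝ → ℝ)
    {a b : ℝ} (hab : a ≤ b) (hF : ∀ j, ContinuousOn (fun τ => F τ j) (Set.Icc a b))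
    (hG : ContinuousOn G (Set.Icc a b)) (hv : ∀ j, v j = ∫ τ in a..b, F τ j)
    (hbound : ∀ τ ∈ Set.Icc a b, Real.sqrt (∑ j, ‖F τ j‖ ^ 2) ≤ G τ) :
    Real.sqrt (∑ j, ‖v j‖ ^ 2) ≤ ∫ τ in a..b, G τ := by
  set nv : ℝ := Real.sqrt (∑ j, ‖v j‖ ^ 2) with hnv
  have hnv0 : 0 ≤ nv := Real.sqrt_nonneg _
  have huIcc : Set.uIcc a b = Set.Icc a b := Set.uIcc_of_le hab
  have hFi : ∀ j, IntervalIntegrable (fun τ => F τ j) volume a b := fun j =>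
    (hF j).intervalIntegrable_of_Icc hab
  -- `G ≥ 0` on the interval, hence `∫ G ≥ 0`
  have hG0 : ∀ τ ∈ Set.Icc a b, 0 ≤ G τ := fun τ hτ => (Real.sqrt_nonneg _).trans (hbound τ hτ)
  have hIG : 0 ≤ ∫ τ in a..b, G τ := intervalIntegral.integral_nonneg hab hG0
  -- the pairing of `v` with itself
  have hpair : ((nv ^ 2 : ℝ) : ℂ) = ∑ j, conj (v j) * v j := by
    rw [hnv, Real.sq_sqrt (Finset.sum_nonneg fun _ _ => by positivity)]
    push_cast
    refine Finset.sum_congr rfl fun j _ => ?_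
    rw [Complex.conj_mul', ← Complex.ofReal_pow]
  -- move the integral out of the pairing
  have hswap : ∑ j, conj (v j) * v j = ∫ τ in a..b, ∑ j, conj (v j) * F τ j := by
    rw [intervalIntegral.integral_finsetSum fun j _ => (hFi j).const_mul _]
    refine Finset.sum_congr rfl fun j _ => ?_
    rw [intervalIntegral.integral_const_mul, ← hv j]
  -- pointwise Cauchy–Schwarz against `G`
  have hpt : ∀ τ ∈ Set.Icc a b, ‖∑ j, conj (v j) * F τ j‖ ≤ nv * G τ := fun τ hτ =>
    (norm_sum_conj_mul_le v (F τ)).trans (mul_le_mul_of_nonneg_left (hbound τ hτ) hnv0)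
  have hcont : ContinuousOn (fun τ => ∑ j, conj (v j) * F τ j) (Set.Icc a b) :=
    continuousOn_finsetSum _ fun j _ => (hF j).const_smul (conj (v j)) |>.congr fun τ _ => by
      simp [smul_eq_mul]
  have hsq : nv ^ 2 ≤ nv * ∫ τ in a..b, G τ := by
    have h1 : nv ^ 2 = ‖∫ τ in a..b, ∑ j, conj (v j) * F τ j‖ := by
      rw [← hswap, ← hpair, Complex.norm_real, Real.norm_eq_abs, abs_of_nonneg (sq_nonneg _)]
    rw [h1]
    calc ‖∫ τ in a..b, ∑ j, conj (v j) * F τ j‖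
        ≤ ∫ τ in a..b, ‖∑ j, conj (v j) * F τ j‖ :=
          intervalIntegral.norm_integral_le_integral_norm hab
      _ ≤ ∫ τ in a..b, nv * G τ := by
          refine intervalIntegral.integral_mono_on hab ?_ ?_ fun τ hτ => hpt τ hτ
          · exact (hcont.norm).intervalIntegrable_of_Icc hab
          · exact (hG.const_smul nv |>.congr fun τ _ => by simp [smul_eq_mul]).intervalIntegrable_of_Icc hab
      _ = nv * ∫ τ in a..b, G τ := intervalIntegral.integral_const_mul _ _
  exact sqrt_le_of_sq_le_mul hnv0 hIG (by rw [mul_comm]; exact hsq)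

/-- **Registered form (stub `stub_rowIntegralDuality` of the crux item)**: the duality form of
Minkowski's integral inequality for a finite row given entrywise by interval integrals
(`sqrt_sum_norm_sq_le_integral_of_forall_le` at `ι : Type`). -/
theorem stub_rowIntegralDuality :
    ∀ (ι : Type) [Fintype ι] (v : ι → ℂ) (F : ℝ → ι → ℂ) (G : ℝ → ℝ) (a b : ℝ), a ≤ b →
      (∀ j, ContinuousOn (fun τ => F τ j) (Set.Icc a b)) → ContinuousOn G (Set.Icc a b) →
      (∀ j, v j = ∫ τ in a..b, F τ j) →
      (∀ τ ∈ Set.Icc a b, Real.sqrt (∑ j, ‖F τ j‖ ^ 2) ≤ G τ) →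
      Real.sqrt (∑ j, ‖v j‖ ^ 2) ≤ ∫ τ in a..b, G τ :=
  fun _ _ v F G _ _ hab hF hG hv hbound =>
    sqrt_sum_norm_sq_le_integral_of_forall_le v F G hab hF hG hv hbound

end Summit.QuantumFields.QCD.Cruxes.SmallFieldUltracontractivity.PointCentredAxialParabolic

end
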